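import Summits.QuantumFields.QCD.Theorems.NestedDissectionSeaEarlyCrosserLawNormalFormLinks

/-!
# Split of the crux `EarlyCrosserLaw` (stmt-QuantumFields-13995) into two leaf sub-cruxes — the glue

Crux-strategist (wall-breaker seat `planner-cstrat-stmt-QuantumFields-13995-p1-0`, 2026-08-17) on the
EXHAUSTED chain of `Summit.QuantumFields.QCD.Theses.NestedDissectionSea.EarlyCrosserLaw`: eight lead
seats, three built lines (`accretive-coarse-jensen`, `kac-rice-hermitian-dos`,
`cells-inherit-torus-extinction`) and ≈ 50 accepted modules left, line-independently, the SAME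
two-piece residual (master certificate `Cruxes/EarlyCrosserLaw/Lines/cells-inherit-torus-extinction-dead.md`
§2–§4, kernel-checked: the lower pin (b) is necessary — `pinnedLine_of_earlyCrosserLaw` — and the
only load-bearing clause — `earlyCrosserLawWithoutLowerPin_holds`; the crux in normal form is
"pin + cover-probability law at the SAME regularisation" — `earlyCrosserLaw_iff_coverProb`).  This file
types that residual as TWO LEAF SUB-CRUX STATEMENTS and proves the glue between them and the crux, so
that the two pieces can be filed as split children of the crux (`ledger route edit --split
EarlyCrosserLaw --into … --glue-by …EarlyCrosserLaw_of_subs`) and be staffed, ideated and disproved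
separately — the pin shareable across routes — instead of re-appearing as the unprovable stubs of a
fourth line.  The two statements (written out in full in the theorem types below; the route's future
child decls unfold to them):

* **N1 `PinnedPhysicalLine`** (`∃`-piece) — for `N_f ∈ {2,3}` ONE admissible regularisation
  (`HasMassScaling`, `HasAsymptoticScaling`) ON THE PHYSICAL BRANCH (`m_crit(k) → 0` in lattice units)
  and a threshold `M₀ ≥ 0` such that for every sea tuple `m > M₀` some physical size `R > 0` carries
  the TWO-SIDED PARITY PIN: (b) `P_pq[Re det D_W(m_crit − a_kM/Z_m) < 0] ≥ 1/4` on every odd torus of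
  side `≥ R` and (b″) `… (m_crit + a_kM/Z_m) … ≤ 1/8` on odd tori of side in `[R, 2R]`, for every
  `M > M₀`, eventually in `k`.  VERBATIM clauses (b) ∧ (b″) of the crux under the crux's own prefix
  (= the registered stub `stub_pinnedLineOnBranch` of skeleton v5, sha 400d77a1, measure spelled as in
  the crux), `let`s expanded.  Content: topological-charge parity on physical tori along an
  asymptotically free trajectory (b) and Mohler–Schaefer extinction of early real modes at fixed
  physical volume (b″).
* **N2 `DiluteAtPinnedLine`** (`∀`-piece, conditional) — for EVERY admissible regularisation on the
  physical branch and every `M₀ ≥ 0` there are a leaf size `b₀ ≥ 2`, a physical window `ℓ > 0` and a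
  threshold shift `C ≥ 0` such that at every data `(m, R)` with `m_f > M₀ + C`, `R > 0` AT WHICH THE
  TWO PINS (b), (b″) HOLD (threshold `M₀`), the window-dilution clause (a′) of the crux holds at
  `(b₀, ℓ, m, R)` — VERBATIM (a′), `let`s expanded.  Content: early crossers of the Dirichlet cells of
  a physical window are window-summably rare once the line is the physical one — the ∀-aligned common
  core of the three dead lines' residual laws (`stub_meanCountLaw`, `stub_coverLaw`,
  `stub_torusLocalExtinctionOnBranch ∧ stub_sheetAttachedRarityOnBranch`), each of which implies it
  through the landed links `coverProbClause_of_meanCountLaw`, `coverProbClause_of_coverLaw` and the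
  v5 composition.

Theorems: `EarlyCrosserLaw_of_subs : N1 → N2 → EarlyCrosserLaw` — THE GLUE (pure logic: N1's `reg`,
`M₀`; N2's `b₀, ℓ, C` at that `M₀`; the crux's threshold is `M₀ + C`; for `m > M₀ + C` take N1's
`R`; (a′) from N2 at the pinned data, (b),(b″) by monotonicity in the threshold);
`pinnedPhysicalLine_iff` / `diluteAtPinnedLine_iff` (`Iff.rfl`: the texts are the landed clause
predicates `PinClause`, `UpperPin`, `DilutionClause` re-assembled); converse sanity
`pinnedPhysicalLine_of_earlyCrosserLaw_of_frame` — the crux together with the route's crux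
`FrameAndSeparatorLaw` (part (α): a two-sided pin forces the branch) gives N1 back, so N1 is the
crux's own pin framed by (α), not a strengthening the route does not already carry; and
`coverProbClause_of_diluteAtPinnedLine` — N2 delivers the normal form `CoverProbClause` at pinned data.
Pure logic over landed theorems; no physics is proved here. [folklore]
-/

noncomputable section

open scoped BigOperators Classical
open Filter MeasureTheory
open Literature.MathematicalPhysics.QuantumLattice Literature.MathematicalPhysics.QuantumFieldTheory
  Literature.Probability.LatticeModels
open Summit.QuantumFields.QCD.Theses.NestedDissectionSea
open Summit.QuantumFields.QCD.Theorems.EarlyCrosserLawNegative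
open Summit.QuantumFields.QCD.Theorems.CoerciveSeaNegative

namespace Summit.QuantumFields.QCD.Cruxes.EarlyCrosserLaw.Split

/-- **N1 read through the landed clause predicates**: the sub-crux text `PinnedPhysicalLine` is,
definitionally, "`∃` admissible branch `reg`, `∃ M₀`, `∀ m > M₀ ∃ R`, `PinClause ∧ UpperPin`".
[folklore] -/
theorem pinnedPhysicalLine_iff :
    (∀ Nf : ℕ, (Nf = 2 ∨ Nf = 3) → ∃ reg : QCDRegularisation Nf, reg.HasMassScaling ∧ (reg.scheme 0 0 0).HasAsymptoticScaling ∧ Filter.Tendsto reg.mcrit Filter.atTop (nhds 0) ∧ ∃ M₀ : ℝ, 0 ≤ M₀ ∧ ∀ m : Fin Nf → ℝ, (∀ f, M₀ < m f) → ∃ R : ℝ, 0 < R ∧ (∀ M : ℝ, M₀ < M → ∀ᶠ k : ℕ in Filter.atTop, ∀ S : ℕ, R ≤ reg.a k * (2 * S + 1) → (1 / 4 : ℝ) ≤ (∫ U, (if (fermionDet (wilsonDirac (fundamentalRep (Fin 3)) U (reg.mcrit k - reg.a k * M / reg.Zm k) 1)).re < 0 then (1 : ℝ) else 0) * (∏ f,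 ‖fermionDet (wilsonDirac (fundamentalRep (Fin 3)) U (reg.mcrit k + reg.a k * m f / reg.Zm k) 1)‖) ∂(wilsonMeasure (d := 4) (L := 2 * S + 1) (fundamentalRep (Fin 3)) (reg.β k))) / (∫ U, (∏ f, ‖fermionDet (wilsonDirac (fundamentalRep (Fin 3)) U (reg.mcrit k + reg.a k * m f / reg.Zm k) 1)‖) ∂(wilsonMeasure (d := 4) (L := 2 * S + 1) (fundamentalRep (Fin 3)) (reg.β k)))) ∧ (∀ M : ℝ, M₀ < M → ∀ᶠ k : ℕ in Filter.atTop, ∀ S : ℕ, R ≤ reg.a k * (2 * S + 1) → reg.a k * (2 * S + 1) ≤ 2 * R → (∫ U, (if (fermionDet (wilsonDirac (fundamentalRep (Fin 3)) U (reg.mcrit k + reg.a k * M / reg.Zm k) 1)).re < 0 then (1 : ℝ) else 0) * (∏ f, ‖fermionDet (wilsonDirac (fundamentalRep (Fin 3)) U (reg.mcrit k + reg.a k * m f / reg.Zm k) 1)‖) ∂(wilsonMeasure (d := 4) (L := 2 * S + 1) (fundamentalRep (Fin 3)) (reg.β k))) / (∫ U, (∏ f, ‖fermionDet (wilsonDirac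 (fundamentalRep (Fin 3)) U (reg.mcrit k + reg.a k * m f / reg.Zm k) 1)‖) ∂(wilsonMeasure (d := 4) (L := 2 * S + 1) (fundamentalRep (Fin 3)) (reg.β k))) ≤ (1 / 8 : ℝ))) ↔
    ∀ Nf : ℕ, (Nf = 2 ∨ Nf = 3) → ∃ reg : QCDRegularisation Nf,
      reg.HasMassScaling ∧ (reg.scheme 0 0 0).HasAsymptoticScaling ∧
      Filter.Tendsto reg.mcrit Filter.atTop (nhds 0) ∧ ∃ M₀ : ℝ, 0 ≤ M₀ ∧
      ∀ m : Fin Nf → ℝ, (∀ f, M₀ < m f) → ∃ R : ℝ, 0 < R ∧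
        PinClause Nf reg M₀ m R ∧ UpperPin Nf reg M₀ m R :=
  Iff.rfl

/-- **N2 read through the landed clause predicates**: the sub-crux text `DiluteAtPinnedLine` is,
definitionally, "`∀` admissible branch `reg`, `∀ M₀ ∃ b₀ ℓ C ∀ m > M₀ + C ∀ R`,
`PinClause → UpperPin → DilutionClause`". [folklore] -/
theorem diluteAtPinnedLine_iff :
    (∀ Nf : ℕ, (Nf = 2 ∨ Nf = 3) → ∀ reg : QCDRegularisation Nf, reg.HasMassScaling → (reg.scheme 0 0 0).HasAsymptoticScaling → Filter.Tendsto reg.mcrit Filter.atTop (nhds 0) → ∀ M₀ : ℝ, 0 ≤ M₀ → ∃ b₀ : ℕ, 2 ≤ b₀ ∧ ∃ ℓ : ℝ, 0 < ℓ ∧ ∃ C : ℝ, 0 ≤ C ∧ ∀ m : Fin Nf → ℝ, (∀ f, M₀ + C < m f) → ∀ R : ℝ, 0 < R → (∀ M : ℝ, M₀ < M → ∀ᶠ k : ℕ in Filter.atTop, ∀ S : ℕ, R ≤ reg.a k * (2 * S + 1) → (1 / 4 : ℝ) ≤ (∫ U, (if (fermionDet (wilsonDirac (fundamentalRep (Fin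 3)) U (reg.mcrit k - reg.a k * M / reg.Zm k) 1)).re < 0 then (1 : ℝ) else 0) * (∏ f, ‖fermionDet (wilsonDirac (fundamentalRep (Fin 3)) U (reg.mcrit k + reg.a k * m f / reg.Zm k) 1)‖) ∂(wilsonMeasure (d := 4) (L := 2 * S + 1) (fundamentalRep (Fin 3)) (reg.β k))) / (∫ U, (∏ f, ‖fermionDet (wilsonDirac (fundamentalRep (Fin 3)) U (reg.mcrit k + reg.a k * m f / reg.Zm k) 1)‖) ∂(wilsonMeasure (d := 4) (L := 2 * S + 1) (fundamentalRep (Fin 3)) (reg.β k)))) → (∀ M : ℝ, M₀ < M → ∀ᶠ k : ℕ in Filter.atTop, ∀ S : ℕ, R ≤ reg.a k * (2 * S + 1) → reg.a k * (2 * S + 1) ≤ 2 * R → (∫ U, (if (fermionDet (wilsonDirac (fundamentalRep (Fin 3)) U (reg.mcrit k + reg.a k * M / reg.Zm k) 1)).re < 0 then (1 : ℝ) else 0) * (∏ f, ‖fermionDet (wilsonDirac (fundamentalRep (Fin 3)) U (reg.mcrit k + reg.a k * m f / reg.Zm k) 1)‖) ∂(wilsonMeasure (d := 4) (L := 2 *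 S + 1) (fundamentalRep (Fin 3)) (reg.β k))) / (∫ U, (∏ f, ‖fermionDet (wilsonDirac (fundamentalRep (Fin 3)) U (reg.mcrit k + reg.a k * m f / reg.Zm k) 1)‖) ∂(wilsonMeasure (d := 4) (L := 2 * S + 1) (fundamentalRep (Fin 3)) (reg.β k))) ≤ (1 / 8 : ℝ)) → (∀ ε : ℝ, 0 < ε → ∀ᶠ k : ℕ in Filter.atTop, ∀ S : ℕ, R ≤ reg.a k * (2 * S + 1) → ∃ δ : ℕ → ℝ, (∀ j, 0 ≤ δ j) ∧ ∑ j ∈ Finset.range (Nat.log 2 (⌊ℓ / reg.a k⌋₊ / b₀) + 1), δ j ≤ ε ∧ ∀ j < (Nat.log 2 (⌊ℓ / reg.a k⌋₊ / b₀) + 1), ∀ s : Fin 4 → ℕ, (∀ i, b₀ * 2 ^ j ≤ s i ∧ s i < b₀ * 2 ^ (j + 2) ∧ s i ≤ 2 * S + 1 ∧ (s i : ℝ) * reg.a k ≤ ℓ) → ∀ E : GaugeConfig 4 (2 * S + 1) (Matrix.specialUnitaryGroup (Fin 3) ℂ) → Prop, (∀ U, E U → ∃ f : Fin Nf, ∃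 μ' : ℝ, reg.mcrit k + reg.a k * m f / reg.Zm k ≤ μ' ∧ ((wilsonCell U μ' 0 s).det = 0 ∨ ∃ c : Fin 4 → Bool, (wilsonCell U μ' (halfCorner s c) (halfSides s c)).det = 0)) → (∫ U, (if E U then (1 : ℝ) else 0) * (∏ f, ‖fermionDet (wilsonDirac (fundamentalRep (Fin 3)) U (reg.mcrit k + reg.a k * m f / reg.Zm k) 1)‖) ∂(wilsonMeasure (d := 4) (L := 2 * S + 1) (fundamentalRep (Fin 3)) (reg.β k))) / (∫ U, (∏ f, ‖fermionDet (wilsonDirac (fundamentalRep (Fin 3)) U (reg.mcrit k + reg.a k * m f / reg.Zm k) 1)‖) ∂(wilsonMeasure (d := 4) (L := 2 * S + 1) (fundamentalRep (Fin 3)) (reg.β k))) ≤ δ j)) ↔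
    ∀ Nf : ℕ, (Nf = 2 ∨ Nf = 3) → ∀ reg : QCDRegularisation Nf,
      reg.HasMassScaling → (reg.scheme 0 0 0).HasAsymptoticScaling →
      Filter.Tendsto reg.mcrit Filter.atTop (nhds 0) → ∀ M₀ : ℝ, 0 ≤ M₀ → ∃ b₀ : ℕ, 2 ≤ b₀ ∧
      ∃ ℓ : ℝ, 0 < ℓ ∧ ∃ C : ℝ, 0 ≤ C ∧ ∀ m : Fin Nf → ℝ, (∀ f, M₀ + C < m f) → ∀ R : ℝ, 0 < R →
        PinClause Nf reg M₀ m R → UpperPin Nf reg M₀ m R → DilutionClause Nf reg b₀ ℓ m R :=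
  Iff.rfl

/-- **THE GLUE `N1 → N2 → EarlyCrosserLaw`** (hypotheses = the two sub-crux texts verbatim, so that
the route's child decls unfold to them; conclusion = the crux BY NAME). [folklore] -/
theorem EarlyCrosserLaw_of_subs :
    (∀ Nf : ℕ, (Nf = 2 ∨ Nf = 3) → ∃ reg : QCDRegularisation Nf, reg.HasMassScaling ∧ (reg.scheme 0 0 0).HasAsymptoticScaling ∧ Filter.Tendsto reg.mcrit Filter.atTop (nhds 0) ∧ ∃ M₀ : ℝ, 0 ≤ M₀ ∧ ∀ m : Fin Nf → ℝ, (∀ f, M₀ < m f) → ∃ R : ℝ, 0 < R ∧ (∀ M : ℝ, M₀ < M → ∀ᶠ k : ℕ in Filter.atTop, ∀ S : ℕ, R ≤ reg.a k * (2 * S + 1) → (1 / 4 : ℝ) ≤ (∫ U, (if (fermionDet (wilsonDirac (fundamentalRep (Fin 3)) U (reg.mcrit k - reg.a k * M / reg.Zm k) 1)).re < 0 then (1 : ℝ) else 0) * (∏ f, ‖fermionDet (wilsonDirac (fundamentalRep (Fin 3)) U (reg.mcrit k + reg.a k * m f / reg.Zm k) 1)‖) ∂(wilsonMeasure (d :=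 4) (L := 2 * S + 1) (fundamentalRep (Fin 3)) (reg.β k))) / (∫ U, (∏ f, ‖fermionDet (wilsonDirac (fundamentalRep (Fin 3)) U (reg.mcrit k + reg.a k * m f / reg.Zm k) 1)‖) ∂(wilsonMeasure (d := 4) (L := 2 * S + 1) (fundamentalRep (Fin 3)) (reg.β k)))) ∧ (∀ M : ℝ, M₀ < M → ∀ᶠ k : ℕ in Filter.atTop, ∀ S : ℕ, R ≤ reg.a k * (2 * S + 1) → reg.a k * (2 * S + 1) ≤ 2 * R → (∫ U, (if (fermionDet (wilsonDirac (fundamentalRep (Fin 3)) U (reg.mcrit k + reg.a k * M / reg.Zm k) 1)).re < 0 then (1 : ℝ) else 0) * (∏ f, ‖fermionDet (wilsonDirac (fundamentalRep (Fin 3)) U (reg.mcrit k + reg.a k * m f / reg.Zm k) 1)‖) ∂(wilsonMeasure (d := 4) (L := 2 * S + 1) (fundamentalRep (Fin 3)) (reg.β k))) / (∫ U, (∏ f, ‖fermionDet (wilsonDirac (fundamentalRep (Fin 3)) U (reg.mcrit k + reg.a k * m f / reg.Zm k) 1)‖) ∂(wilsonMeasure (d := 4) (L := 2 * S + 1) (fundamentalRep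 (Fin 3)) (reg.β k))) ≤ (1 / 8 : ℝ))) →
    (∀ Nf : ℕ, (Nf = 2 ∨ Nf = 3) → ∀ reg : QCDRegularisation Nf, reg.HasMassScaling → (reg.scheme 0 0 0).HasAsymptoticScaling → Filter.Tendsto reg.mcrit Filter.atTop (nhds 0) → ∀ M₀ : ℝ, 0 ≤ M₀ → ∃ b₀ : ℕ, 2 ≤ b₀ ∧ ∃ ℓ : ℝ, 0 < ℓ ∧ ∃ C : ℝ, 0 ≤ C ∧ ∀ m : Fin Nf → ℝ, (∀ f, M₀ + C < m f) → ∀ R : ℝ, 0 < R → (∀ M : ℝ, M₀ < M → ∀ᶠ k : ℕ in Filter.atTop, ∀ S : ℕ, R ≤ reg.a k * (2 * S + 1) → (1 / 4 : ℝ) ≤ (∫ U, (if (fermionDet (wilsonDirac (fundamentalRep (Fin 3)) U (reg.mcrit k - reg.a k * M / reg.Zm k) 1)).re < 0 then (1 : ℝ) else 0) * (∏ f, ‖fermionDet (wilsonDirac (fundamentalRep (Fin 3)) U (reg.mcrit k + reg.a k * m f / reg.Zm k) 1)‖) ∂(wilsonMeasure (d := 4) (L := 2 * S + 1) (fundamentalRep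 (Fin 3)) (reg.β k))) / (∫ U, (∏ f, ‖fermionDet (wilsonDirac (fundamentalRep (Fin 3)) U (reg.mcrit k + reg.a k * m f / reg.Zm k) 1)‖) ∂(wilsonMeasure (d := 4) (L := 2 * S + 1) (fundamentalRep (Fin 3)) (reg.β k)))) → (∀ M : ℝ, M₀ < M → ∀ᶠ k : ℕ in Filter.atTop, ∀ S : ℕ, R ≤ reg.a k * (2 * S + 1) → reg.a k * (2 * S + 1) ≤ 2 * R → (∫ U, (if (fermionDet (wilsonDirac (fundamentalRep (Fin 3)) U (reg.mcrit k + reg.a k * M / reg.Zm k) 1)).re < 0 then (1 : ℝ) else 0) * (∏ f, ‖fermionDet (wilsonDirac (fundamentalRep (Fin 3)) U (reg.mcrit k + reg.a k * m f / reg.Zm k) 1)‖) ∂(wilsonMeasure (d := 4) (L := 2 * S + 1) (fundamentalRep (Fin 3)) (reg.β k))) / (∫ U, (∏ f, ‖fermionDet (wilsonDirac (fundamentalRep (Fin 3)) U (reg.mcrit k + reg.a k * m f / reg.Zm k) 1)‖) ∂(wilsonMeasure (d := 4) (L := 2 * S + 1) (fundamentalRep (Fin 3)) (reg.β k))) ≤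 (1 / 8 : ℝ)) → (∀ ε : ℝ, 0 < ε → ∀ᶠ k : ℕ in Filter.atTop, ∀ S : ℕ, R ≤ reg.a k * (2 * S + 1) → ∃ δ : ℕ → ℝ, (∀ j, 0 ≤ δ j) ∧ ∑ j ∈ Finset.range (Nat.log 2 (⌊ℓ / reg.a k⌋₊ / b₀) + 1), δ j ≤ ε ∧ ∀ j < (Nat.log 2 (⌊ℓ / reg.a k⌋₊ / b₀) + 1), ∀ s : Fin 4 → ℕ, (∀ i, b₀ * 2 ^ j ≤ s i ∧ s i < b₀ * 2 ^ (j + 2) ∧ s i ≤ 2 * S + 1 ∧ (s i : ℝ) * reg.a k ≤ ℓ) → ∀ E : GaugeConfig 4 (2 * S + 1) (Matrix.specialUnitaryGroup (Fin 3) ℂ) → Prop, (∀ U, E U → ∃ f : Fin Nf, ∃ μ' : ℝ, reg.mcrit k + reg.a k * m f / reg.Zm k ≤ μ' ∧ ((wilsonCell U μ' 0 s).det = 0 ∨ ∃ c : Fin 4 → Bool, (wilsonCell U μ' (halfCorner s c) (halfSides s c)).det = 0)) → (∫ U, (if E U then (1 : ℝ) else 0) * (∏ f, ‖fermionDet (wilsonDirac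 (fundamentalRep (Fin 3)) U (reg.mcrit k + reg.a k * m f / reg.Zm k) 1)‖) ∂(wilsonMeasure (d := 4) (L := 2 * S + 1) (fundamentalRep (Fin 3)) (reg.β k))) / (∫ U, (∏ f, ‖fermionDet (wilsonDirac (fundamentalRep (Fin 3)) U (reg.mcrit k + reg.a k * m f / reg.Zm k) 1)‖) ∂(wilsonMeasure (d := 4) (L := 2 * S + 1) (fundamentalRep (Fin 3)) (reg.β k))) ≤ δ j)) →
    EarlyCrosserLaw := by
  intro h₁ h₂ Nf hNf
  obtain ⟨reg, hms, has, hbr, M₀, hM₀, hpin⟩ := h₁ Nf hNf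
  obtain ⟨b₀, hb₀, ℓ, hℓ, C, hC, hcov⟩ := h₂ Nf hNf reg hms has hbr M₀ hM₀
  refine ⟨reg, hms, has, M₀ + C, by positivity, b₀, hb₀, ℓ, hℓ, fun m hm => ?_⟩
  have hm' : ∀ f, M₀ < m f := fun f => by linarith [hm f]
  obtain ⟨R, hR, hlow, hup⟩ := hpin m hm'
  have hdil := hcov m hm R hR hlow hup
  refine ⟨R, hR, ?_, ?_, ?_⟩
  · exact hdil
  · intro M hM
    exact hlow M (by linarith)
  · intro M hM
    exact hup M (by linarith)

/-- **Converse sanity for N1**: the crux together with the frame (α) of the route's crux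
`FrameAndSeparatorLaw` (a two-sided pin above a threshold forces `m_crit → 0`) gives the sub-crux
text `PinnedPhysicalLine` — N1 is the crux's own pin, framed by (α). [folklore] -/
theorem pinnedPhysicalLine_of_earlyCrosserLaw_of_frame (hE : EarlyCrosserLaw)
    (hF : FrameAndSeparatorLaw) :
    (∀ Nf : ℕ, (Nf = 2 ∨ Nf = 3) → ∃ reg : QCDRegularisation Nf, reg.HasMassScaling ∧ (reg.scheme 0 0 0).HasAsymptoticScaling ∧ Filter.Tendsto reg.mcrit Filter.atTop (nhds 0) ∧ ∃ M₀ : ℝ, 0 ≤ M₀ ∧ ∀ m : Fin Nf → ℝ, (∀ f, M₀ < m f) → ∃ R : ℝ, 0 < R ∧ (∀ M : ℝ, M₀ < M → ∀ᶠ k : ℕ in Filter.atTop, ∀ S : ℕ, R ≤ reg.a k * (2 * S + 1) → (1 / 4 : ℝ) ≤ (∫ U, (if (fermionDet (wilsonDirac (fundamentalRep (Fin 3)) U (reg.mcrit k - reg.a k * M / reg.Zm k) 1)).re < 0 then (1 : ℝ) else 0) * (∏ f, ‖fermionDet (wilsonDirac (fundamentalRep (Fin 3)) U (reg.mcrit k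 + reg.a k * m f / reg.Zm k) 1)‖) ∂(wilsonMeasure (d := 4) (L := 2 * S + 1) (fundamentalRep (Fin 3)) (reg.β k))) / (∫ U, (∏ f, ‖fermionDet (wilsonDirac (fundamentalRep (Fin 3)) U (reg.mcrit k + reg.a k * m f / reg.Zm k) 1)‖) ∂(wilsonMeasure (d := 4) (L := 2 * S + 1) (fundamentalRep (Fin 3)) (reg.β k)))) ∧ (∀ M : ℝ, M₀ < M → ∀ᶠ k : ℕ in Filter.atTop, ∀ S : ℕ, R ≤ reg.a k * (2 * S + 1) → reg.a k * (2 * S + 1) ≤ 2 * R → (∫ U, (if (fermionDet (wilsonDirac (fundamentalRep (Fin 3)) U (reg.mcrit k + reg.a k * M / reg.Zm k) 1)).re < 0 then (1 : ℝ) else 0) * (∏ f, ‖fermionDet (wilsonDirac (fundamentalRep (Fin 3)) U (reg.mcrit k + reg.a k * m f / reg.Zm k) 1)‖) ∂(wilsonMeasure (d := 4) (L := 2 * S + 1) (fundamentalRep (Fin 3)) (reg.β k))) / (∫ U, (∏ f, ‖fermionDet (wilsonDirac (fundamentalRep (Fin 3)) U (reg.mcrit k + reg.a k * m f / reg.Zm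 k) 1)‖) ∂(wilsonMeasure (d := 4) (L := 2 * S + 1) (fundamentalRep (Fin 3)) (reg.β k))) ≤ (1 / 8 : ℝ))) := by
  intro Nf hNf
  obtain ⟨reg, hms, has, M₀, hM₀, b₀, -, ℓ, -, hm⟩ := hE Nf hNf
  have hpin : ∀ m : Fin Nf → ℝ, (∀ f, M₀ < m f) → ∃ R : ℝ, 0 < R ∧
      PinClause Nf reg M₀ m R ∧ UpperPin Nf reg M₀ m R := by
    intro m hmm
    obtain ⟨R, hR, -, hlow, hup⟩ := hm m hmm
    exact ⟨R, hR, hlow, hup⟩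
  have hbr : Filter.Tendsto reg.mcrit Filter.atTop (nhds 0) := by
    refine hF.1 Nf reg hNf hms has M₀ hM₀ ?_
    intro m hmm
    obtain ⟨R, hR, hlow, hup⟩ := hpin m hmm
    refine ⟨R, hR, fun M hM => ?_⟩
    filter_upwards [hlow M hM, hup M hM] with k hk₁ hk₂
    intro S hS
    exact ⟨hk₁ S hS, fun hS' => hk₂ S hS hS'⟩
  exact ⟨reg, hms, has, hbr, M₀, hM₀, hpin⟩

/-- **N2 delivers the normal form at pinned data**: along an admissible branch regularisation and a
threshold `M₀`, the sub-crux text `DiluteAtPinnedLine` yields `b₀, ℓ` and a shift `C` above which every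
pinned `(m, R)` carries `NormalForm.CoverProbClause` (by `dilutionClause_iff_coverProbClause`) — i.e.
with N1's witness, exactly the merged Form B‴ node of `EarlyCrosserLaw_of_pinnedCoverLawOnBranch`.
[folklore] -/
theorem coverProbClause_of_diluteAtPinnedLine
    (h₂ : ∀ Nf : ℕ, (Nf = 2 ∨ Nf = 3) → ∀ reg : QCDRegularisation Nf, reg.HasMassScaling → (reg.scheme 0 0 0).HasAsymptoticScaling → Filter.Tendsto reg.mcrit Filter.atTop (nhds 0) → ∀ M₀ : ℝ, 0 ≤ M₀ → ∃ b₀ : ℕ, 2 ≤ b₀ ∧ ∃ ℓ : ℝ, 0 < ℓ ∧ ∃ C : ℝ, 0 ≤ C ∧ ∀ m : Fin Nf → ℝ, (∀ f, M₀ + C < m f) → ∀ R : ℝ, 0 < R → (∀ M : ℝ, M₀ < M → ∀ᶠ k : ℕ in Filter.atTop, ∀ S : ℕ, R ≤ reg.a k * (2 * S + 1) → (1 / 4 : ℝ) ≤ (∫ U, (if (fermionDet (wilsonDirac (fundamentalRep (Fin 3)) U (reg.mcrit k - reg.a k * M / reg.Zm k) 1)).re < 0 then (1 : ℝ) else 0)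 * (∏ f, ‖fermionDet (wilsonDirac (fundamentalRep (Fin 3)) U (reg.mcrit k + reg.a k * m f / reg.Zm k) 1)‖) ∂(wilsonMeasure (d := 4) (L := 2 * S + 1) (fundamentalRep (Fin 3)) (reg.β k))) / (∫ U, (∏ f, ‖fermionDet (wilsonDirac (fundamentalRep (Fin 3)) U (reg.mcrit k + reg.a k * m f / reg.Zm k) 1)‖) ∂(wilsonMeasure (d := 4) (L := 2 * S + 1) (fundamentalRep (Fin 3)) (reg.β k)))) → (∀ M : ℝ, M₀ < M → ∀ᶠ k : ℕ in Filter.atTop, ∀ S : ℕ, R ≤ reg.a k * (2 * S + 1) → reg.a k * (2 * S + 1) ≤ 2 * R → (∫ U, (if (fermionDet (wilsonDirac (fundamentalRep (Fin 3)) U (reg.mcrit k + reg.a k * M / reg.Zm k) 1)).re < 0 then (1 : ℝ) else 0) * (∏ f, ‖fermionDet (wilsonDirac (fundamentalRep (Fin 3)) U (reg.mcrit k + reg.a k * m f / reg.Zm k) 1)‖) ∂(wilsonMeasure (d := 4) (L := 2 * S + 1) (fundamentalRep (Fin 3)) (reg.β k))) / (∫ U, (∏ f, ‖fermionDet (wilsonDirac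 (fundamentalRep (Fin 3)) U (reg.mcrit k + reg.a k * m f / reg.Zm k) 1)‖) ∂(wilsonMeasure (d := 4) (L := 2 * S + 1) (fundamentalRep (Fin 3)) (reg.β k))) ≤ (1 / 8 : ℝ)) → (∀ ε : ℝ, 0 < ε → ∀ᶠ k : ℕ in Filter.atTop, ∀ S : ℕ, R ≤ reg.a k * (2 * S + 1) → ∃ δ : ℕ → ℝ, (∀ j, 0 ≤ δ j) ∧ ∑ j ∈ Finset.range (Nat.log 2 (⌊ℓ / reg.a k⌋₊ / b₀) + 1), δ j ≤ ε ∧ ∀ j < (Nat.log 2 (⌊ℓ / reg.a k⌋₊ / b₀) + 1), ∀ s : Fin 4 → ℕ, (∀ i, b₀ * 2 ^ j ≤ s i ∧ s i < b₀ * 2 ^ (j + 2) ∧ s i ≤ 2 * S + 1 ∧ (s i : ℝ) * reg.a k ≤ ℓ) → ∀ E : GaugeConfig 4 (2 * S + 1) (Matrix.specialUnitaryGroup (Fin 3) ℂ) → Prop, (∀ U, E U → ∃ f : Fin Nf, ∃ μ' : ℝ, reg.mcrit k + reg.a k * m f / reg.Zm k ≤ μ' ∧ ((wilsonCell U μ'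 0 s).det = 0 ∨ ∃ c : Fin 4 → Bool, (wilsonCell U μ' (halfCorner s c) (halfSides s c)).det = 0)) → (∫ U, (if E U then (1 : ℝ) else 0) * (∏ f, ‖fermionDet (wilsonDirac (fundamentalRep (Fin 3)) U (reg.mcrit k + reg.a k * m f / reg.Zm k) 1)‖) ∂(wilsonMeasure (d := 4) (L := 2 * S + 1) (fundamentalRep (Fin 3)) (reg.β k))) / (∫ U, (∏ f, ‖fermionDet (wilsonDirac (fundamentalRep (Fin 3)) U (reg.mcrit k + reg.a k * m f / reg.Zm k) 1)‖) ∂(wilsonMeasure (d := 4) (L := 2 * S + 1) (fundamentalRep (Fin 3)) (reg.β k))) ≤ δ j))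
    {Nf : ℕ} (hNf : Nf = 2 ∨ Nf = 3) (reg : QCDRegularisation Nf) (hms : reg.HasMassScaling)
    (has : (reg.scheme 0 0 0).HasAsymptoticScaling)
    (hbr : Filter.Tendsto reg.mcrit Filter.atTop (nhds 0)) {M₀ : ℝ} (hM₀ : 0 ≤ M₀) :
    ∃ b₀ : ℕ, 2 ≤ b₀ ∧ ∃ ℓ : ℝ, 0 < ℓ ∧ ∃ C : ℝ, 0 ≤ C ∧ ∀ m : Fin Nf → ℝ, (∀ f, M₀ + C < m f) →
      ∀ R : ℝ, 0 < R → PinClause Nf reg M₀ m R → UpperPin Nf reg M₀ m R →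
        NormalForm.CoverProbClause Nf reg b₀ ℓ m R := by
  obtain ⟨b₀, hb₀, ℓ, hℓ, C, hC, hcov⟩ := (diluteAtPinnedLine_iff.mp h₂) Nf hNf reg hms has hbr M₀ hM₀
  refine ⟨b₀, hb₀, ℓ, hℓ, C, hC, fun m hm R hR hlow hup => ?_⟩
  exact (NormalForm.dilutionClause_iff_coverProbClause Nf reg b₀ ℓ m R).mp (hcov m hm R hR hlow hup)

end Summit.QuantumFields.QCD.Cruxes.EarlyCrosserLaw.Split

end
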